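import Summits.CriticalPhenomena.PercolationContinuityZ3.Theorems.PercNearOneGluingNoHeavyLowerTailReimerCertificate
import HarnessLib

/-!
# Fractional Reimer certificates

Support file for `stmt-CriticalPhenomena-4575` (memo `prim-gen-kcluster/KCLUSTER-gen76.md` §0.4, §4;
conjecture ANTI₁ of `KCLUSTER-gen52.md` §3).  No definitions, no named facts, no sorries.

`ReimerCertificate.card_le_of_certificate` proves `#L ≤ #R` from a *partition* of `L` into classes whose
cylinders lie in the target (F) and whose normalised images are disjoint (D).  Disjointness forces a
canonical rule to break ties (two maximal blobs, two symmetric pockets, …).  The *fractional* form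
replaces the partition by a weighted cover: a finite family of classes `X k ⊆ L` (`k ∈ K`; a point may lie
in several classes), each with its own flip sets `T k x` and target side `tgt k` and satisfying (F), and
rational weights `wt k ≥ 0` such that

* (coverage) every `x ∈ L` has `∑ {k ∈ K | x ∈ X k} wt k ≥ 1`, and
* (packing) every `w ∈ R` has `∑ {k ∈ K | w ∈ J k} wt k ≤ 1`, where `J k` is the normalised image of
  class `k` (the normalised cylinder points of pairs of members).

**Theorem** (`ReimerCertificate.card_le_of_fractionalCertificate`): then `#L ≤ #R`.  Proof: Reimer's
butterfly lemma gives `#(X k) ≤ #(I k) = #(J k)` per class; double counting gives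
`#L ≤ ∑ₖ wt k · #(X k) ≤ ∑ₖ wt k · #(J k) = ∑_{w} ∑_{k : w ∈ J k} wt k ≤ #R`.  Ties and symmetric
configurations need no breaking: average over all choices.  `AntipodalR1.card_lSet_le_of_fractionalCertificate`
is the specialisation to ANTI₁ (`L = lSet`, targets `rSet a b c` / `rSet a c b`).
-/

namespace Summit.CriticalPhenomena.PercolationContinuityZ3.Theorems

namespace ReimerCertificate

open Finset

variable {α : Type*} [Fintype α] [DecidableEq α]

/-- **Fractional Reimer certificates prove the counting inequality.**  `L, R` finite families of points of
the cube `α → Bool`; a finite family of classes `X k` (`k ∈ K`) with flip sets `T k x` and target sides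
`tgt k`; nonnegative rational weights `wt k`.  If (F) every point of a cylinder `Z(x₁,x₂)` of two members
of class `k` (`z = x₁` off `T k x₁`, `z = x̄₂` on `T k x₂`), normalised by `tgt k`, lies in `R`; (C) the
classes containing any `x ∈ L` have total weight `≥ 1`; (P) for every `w`, the classes whose normalised
cylinders contain `w` have total weight `≤ 1` — then `#L ≤ #R`.
[this work; engine: `reimer_butterfly_card_le`, cite: ReimerCPC2000, Thm. 1.2] -/
theorem card_le_of_fractionalCertificate {κ : Type*} [DecidableEq κ]
    (L R : Finset (α → Bool)) (K : Finset κ) (X : κ → Finset (α → Bool))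
    (T : κ → (α → Bool) → Finset α) (tgt : κ → Bool) (wt : κ → ℚ)
    (hwt : ∀ k ∈ K, 0 ≤ wt k)
    (hF : ∀ k ∈ K, ∀ x₁ ∈ X k, ∀ x₂ ∈ X k, ∀ z : α → Bool, (∀ i, i ∉ T k x₁ → z i = x₁ i) →
      (∀ i ∈ T k x₂, z i = !x₂ i) → (if tgt k then z else fun i => !z i) ∈ R)
    (hC : ∀ x ∈ L, 1 ≤ ∑ k ∈ K.filter (fun k => x ∈ X k), wt k)
    (hP : ∀ w : α → Bool, ∑ k ∈ K.filter (fun k => ∃ x₁ ∈ X k, ∃ x₂ ∈ X k, ∃ z : α → Bool,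
        (∀ i, i ∉ T k x₁ → z i = x₁ i) ∧ (∀ i ∈ T k x₂, z i = !x₂ i) ∧
        (if tgt k then z else fun i => !z i) = w), wt k ≤ 1) :
    L.card ≤ R.card := by
  classical
  -- class images and their normalisations
  let I : κ → Finset (α → Bool) := fun k =>
    ((X k).biUnion fun x => univ.filter fun z : α → Bool => ∀ i ∈ (univ \ T k x), z i = x i) ∩
    ((X k).biUnion fun x => univ.filter fun z : α → Bool => ∀ i, i ∉ (univ \ T k x) → z i = !x i)
  let nrm : Bool → (α → Bool) → (α → Bool) := fun t z => if t then z else fun i => !z i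
  let J : κ → Finset (α → Bool) := fun k => (I k).image (nrm (tgt k))
  -- Reimer's butterfly lemma, one flock per class
  have hI : ∀ k, (X k).card ≤ (I k).card := fun k =>
    Literature.Probability.Percolation.reimer_butterfly_card_le (X k) (fun x => univ \ T k x)
  -- points of a class image are cylinder points of two class members
  have hIcyl : ∀ k, ∀ z ∈ I k, ∃ x₁ ∈ X k, ∃ x₂ ∈ X k,
      (∀ i, i ∉ T k x₁ → z i = x₁ i) ∧ (∀ i ∈ T k x₂, z i = !x₂ i) := by
    intro k z hz
    obtain ⟨hz1, hz2⟩ := mem_inter.1 hz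
    obtain ⟨x₁, hx₁, hz₁⟩ := mem_biUnion.1 hz1
    obtain ⟨x₂, hx₂, hz₂⟩ := mem_biUnion.1 hz2
    have h₁ := (mem_filter.1 hz₁).2
    have h₂ := (mem_filter.1 hz₂).2
    exact ⟨x₁, hx₁, x₂, hx₂, fun i hi => h₁ i (mem_sdiff.2 ⟨mem_univ i, hi⟩),
      fun i hi => h₂ i (fun h => (mem_sdiff.1 h).2 hi)⟩
  have hJcard : ∀ k, (J k).card = (I k).card := fun k =>
    card_image_of_injective _ (norm_injective (tgt k))
  have hJsub : ∀ k ∈ K, J k ⊆ R := by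
    intro k hk w hw
    obtain ⟨z, hz, rfl⟩ := mem_image.1 hw
    obtain ⟨x₁, hx₁, x₂, hx₂, hc₁, hc₂⟩ := hIcyl k z hz
    exact hF k hk x₁ hx₁ x₂ hx₂ z hc₁ hc₂
  -- membership in `J k` implies the packing predicate
  have hJpred : ∀ k (w : α → Bool), w ∈ J k → ∃ x₁ ∈ X k, ∃ x₂ ∈ X k, ∃ z : α → Bool,
      (∀ i, i ∉ T k x₁ → z i = x₁ i) ∧ (∀ i ∈ T k x₂, z i = !x₂ i) ∧ nrm (tgt k) z = w := by
    intro k w hw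
    obtain ⟨z, hz, hzw⟩ := mem_image.1 hw
    obtain ⟨x₁, hx₁, x₂, hx₂, hc₁, hc₂⟩ := hIcyl k z hz
    exact ⟨x₁, hx₁, x₂, hx₂, z, hc₁, hc₂, hzw⟩
  -- (1) coverage: #L ≤ ∑ₖ wt k · #(X k ∩ L) ≤ ∑ₖ wt k · #(X k)
  have h1 : (L.card : ℚ) ≤ ∑ k ∈ K, wt k * ((X k).card : ℚ) := by
    calc (L.card : ℚ) = ∑ x ∈ L, (1 : ℚ) := by simp
      _ ≤ ∑ x ∈ L, ∑ k ∈ K.filter (fun k => x ∈ X k), wt k := sum_le_sum fun x hx => hC x hx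
      _ = ∑ x ∈ L, ∑ k ∈ K, (if x ∈ X k then wt k else 0) := by
          refine sum_congr rfl fun x _ => ?_
          rw [sum_filter]
      _ = ∑ k ∈ K, ∑ x ∈ L, (if x ∈ X k then wt k else 0) := sum_comm
      _ = ∑ k ∈ K, wt k * ((L.filter fun x => x ∈ X k).card : ℚ) := by
          refine sum_congr rfl fun k _ => ?_
          rw [← sum_filter, sum_const, nsmul_eq_mul, mul_comm]
      _ ≤ ∑ k ∈ K, wt k * ((X k).card : ℚ) := by
          refine sum_le_sum fun k hk => mul_le_mul_of_nonneg_left ?_ (hwt k hk)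
          exact_mod_cast card_le_card (fun x hx => (mem_filter.1 hx).2)
  -- (2) Reimer per class: ∑ₖ wt k · #(X k) ≤ ∑ₖ wt k · #(J k)
  have h2 : ∑ k ∈ K, wt k * ((X k).card : ℚ) ≤ ∑ k ∈ K, wt k * ((J k).card : ℚ) := by
    refine sum_le_sum fun k hk => mul_le_mul_of_nonneg_left ?_ (hwt k hk)
    rw [hJcard k]
    exact_mod_cast hI k
  -- (3) packing: ∑ₖ wt k · #(J k) = ∑_{w ∈ ⋃ J} ∑_{k : w ∈ J k} wt k ≤ #(⋃ J) ≤ #R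
  have h3 : ∑ k ∈ K, wt k * ((J k).card : ℚ) ≤ (R.card : ℚ) := by
    set U : Finset (α → Bool) := K.biUnion J with hU
    have hUsub : U ⊆ R := biUnion_subset.2 hJsub
    have hfilt : ∀ k ∈ K, U.filter (fun w => w ∈ J k) = J k := by
      intro k hk
      ext w
      simp only [mem_filter, and_iff_right_iff_imp]
      exact fun hw => mem_biUnion.2 ⟨k, hk, hw⟩
    calc ∑ k ∈ K, wt k * ((J k).card : ℚ)
          = ∑ k ∈ K, ∑ w ∈ U, (if w ∈ J k then wt k else 0) := by
            refine sum_congr rfl fun k hk => ?_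
            rw [← sum_filter, hfilt k hk, sum_const, nsmul_eq_mul, mul_comm]
      _ = ∑ w ∈ U, ∑ k ∈ K, (if w ∈ J k then wt k else 0) := sum_comm
      _ = ∑ w ∈ U, ∑ k ∈ K.filter (fun k => w ∈ J k), wt k := by
            refine sum_congr rfl fun w _ => ?_
            rw [sum_filter]
      _ ≤ ∑ w ∈ U, (1 : ℚ) := by
            refine sum_le_sum fun w _ => ?_
            refine le_trans (sum_le_sum_of_subset_of_nonneg ?_ ?_) (hP w)
            · intro k hk
              rw [mem_filter] at hk ⊢
              exact ⟨hk.1, hJpred k w hk.2⟩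
            · intro k hk _
              exact hwt k (mem_filter.1 hk).1
      _ = (U.card : ℚ) := by simp
      _ ≤ (R.card : ℚ) := by exact_mod_cast card_le_card hUsub
  exact_mod_cast h1.trans (h2.trans h3)

end ReimerCertificate

/-! ### Specialisation to ANTI₁ -/

namespace AntipodalR1

open Finset

variable {V ι : Type*} [Fintype ι] [DecidableEq ι]

/-- **ANTI₁ from a fractional Reimer certificate.**  For a finite multigraph `ends : ι → Sym2 V` and
vertices `a, b, c`: a weighted family of classes `X k ⊆ lSet ends a b c` (`k ∈ K`, weights `wt k ≥ 0`,
flip sets `T k x`, target sides `tgt k` — `rSet ends a b c` for `true`, `rSet ends a c b` for `false`)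
with (F) every cylinder point of two members of a class in the class target, (C) total weight `≥ 1` over
the classes containing each point of `L`, and (P) total weight `≤ 1` over the classes whose normalised
cylinders contain any given colouring, proves `#L ≤ #R(b,c)`.  With 0/1 weights on a partition this is
`card_lSet_le_of_certificate`; fractional weights let a symmetric rule average over ties instead of
breaking them. [this work] -/
theorem card_lSet_le_of_fractionalCertificate {κ : Type*} [DecidableEq κ] (ends : ι → Sym2 V)
    (a b c : V) (K : Finset κ) (X : κ → Finset (ι → Bool)) (T : κ → (ι → Bool) → Finset ι)
    (tgt : κ → Bool) (wt : κ → ℚ) (hwt : ∀ k ∈ K, 0 ≤ wt k)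
    (hF : ∀ k ∈ K, ∀ x₁ ∈ X k, ∀ x₂ ∈ X k, ∀ z : ι → Bool, (∀ i, i ∉ T k x₁ → z i = x₁ i) →
      (∀ i ∈ T k x₂, z i = !x₂ i) → z ∈ (if tgt k then rSet ends a b c else rSet ends a c b))
    (hC : ∀ x ∈ lSet ends a b c, 1 ≤ ∑ k ∈ K.filter (fun k => x ∈ X k), wt k)
    (hP : ∀ w : ι → Bool, ∑ k ∈ K.filter (fun k => ∃ x₁ ∈ X k, ∃ x₂ ∈ X k, ∃ z : ι → Bool,
        (∀ i, i ∉ T k x₁ → z i = x₁ i) ∧ (∀ i ∈ T k x₂, z i = !x₂ i) ∧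
        (if tgt k then z else fun i => !z i) = w), wt k ≤ 1) :
    (lSet ends a b c).card ≤ (rSet ends a b c).card :=
  ReimerCertificate.card_le_of_fractionalCertificate _ _ K X T tgt wt hwt
    (fun k hk x₁ h₁ x₂ h₂ z hz₁ hz₂ => norm_mem_rSet ends a b c _ (hF k hk x₁ h₁ x₂ h₂ z hz₁ hz₂)) hC hP

end AntipodalR1

end Summit.CriticalPhenomena.PercolationContinuityZ3.Theorems
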